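import Literature.AnabelianGeometry.SemiGraphs.SpecialFibreTowerOfCoverings
import Literature.AnabelianGeometry.SemiGraphs.TemperedPiTopologicallyFinitelyGenerated
import Literature.AnabelianGeometry.SemiGraphs.TemperedPiPresentationInputs
import Literature.AnabelianGeometry.SemiGraphs.TemperedEdgeLikeIsInfVerticialHolds
import Literature.AnabelianGeometry.SemiGraphs.TemperedResiduallyFiniteHolds
import Literature.AnabelianGeometry.SemiGraphs.CharacteristicOpenCore
import Literature.AnabelianGeometry.SemiGraphs.OrbitGraphFinite
import HarnessLib

/-!
# The special-fibre tower over `π₁^temp(𝒢)` with the CANONICAL levels — the characteristic open cores — for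
# every finite coherent Thm-3.7 semi-graph of anabelioids ([SemiAnbd] Ex. 3.10 pp. 44–45)

Mochizuki, *Semi-graphs of anabelioids*, Publ. RIMS **42** (2006), §3, Example 3.10, manuscript p. 44 l. 9–11
[cite: MochizukiSemiAnbd2006, Ex 3.10 p.44] ("an exhaustive sequence of open characteristic [hence normal] subgroups of
finite index … `⊆ N_i ⊆ … ⊆ Δ`"), with Prop. 3.6 (iii) p. 38 (residual finiteness of `π₁^temp(𝒢)`) and [IUTchI]
Rmk. 2.5.3 (ii) (E2)/(T3) (topological finite generation).

PROOF-ONLY file (abc-iut cell, layer L3; seat abc-iut-L3-t2 gen 4; no definition, no instance, no named fact).  Sequel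
of `SpecialFibreTowerOfCoverings.lean` (the Ex. 3.10 tower over `π₁^temp(𝒢)` for ANY printed level sequence, fibres the
covering semi-graphs of anabelioids).  Here the level sequence is no longer an input: for `𝒢` FINITE, coherent, with
the hypotheses of Thm. 3.7, the tempered fundamental group `π₁^temp(𝒢)` (`ProfiniteSemiGraph.temperedPi`, Prop.
3.6 (i)(ii)) is topologically finitely generated (seat abc-iut-w4-d071's
`GaloisLevelData.isTopologicallyFinitelyGenerated_temperedPi`), so its CHARACTERISTIC OPEN CORES `charOpenCore` (seat
abc-iut-w4-d053: open, normal, finite index, fixed by every bi-continuous automorphism, cofinal among open finite-index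
subgroups) form a printed level sequence — EXHAUSTIVE by the residual finiteness of `π₁^temp(𝒢)` (Prop. 3.6 (iii),
`TemperedPiResiduallyFinite_holds`) — whence:

* `SpecialFibreTower.exists_temperedPi_charOpenCore` — **for every finite coherent Thm-3.7 semi-graph of anabelioids
  `𝒢`, `SpecialFibreTower (π₁^temp(𝒢))` is INHABITED with levels `charOpenCore (π₁^temp 𝒢) i`, fibres the covering
  semi-graphs of anabelioids of the corresponding connected tempered coverings, admissible kernels `1`** — no level
  data, no profiniteness, no degenerate fibre: the canonical combinatorial tower of Ex. 3.10.

HONEST LIMITS: `𝒢` finite coherent; `Δ := π₁^temp(𝒢)` itself (for a curve, `Δ^temp_X` surjects onto it with large kernel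
— that identification is geometry, not claimed); the levels are the characteristic open cores (print allows any such
sequence).  Nothing of the paper is asserted beyond what is proved; no side is taken on [IUTchIII] Cor. 3.12.
-/

noncomputable section

open CategoryTheory Topology

namespace Literature.AnabelianGeometry.SemiGraphs

open Literature.AlgebraicGeometry.Frobenioids (IsConnectedObj)
open Literature.AnabelianGeometry.AbsoluteAnabelian (IsTopologicallyFinitelyGenerated)
open ProfiniteSemiGraph

universe u

namespace SpecialFibreTower

variable {𝒢 : ProfiniteSemiGraph.{u}}

/-- **`π₁^temp(𝒢)` is topologically finitely generated** for `𝒢` finite and coherent with the hypotheses of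
Prop. 3.6 (the chart group `ProfiniteSemiGraph.temperedPi`; seat abc-iut-w4-d071's theorem at the Galois level data
of `𝒢`). [cite: Mochizuki2012, IUTchI Rem. 2.5.3(ii)(E2) p.53] -/
theorem isTopologicallyFinitelyGenerated_temperedPi_of_coherent [Finite 𝒢.graph.Vertex] [Finite 𝒢.graph.Edge]
    (h36 : 𝒢.Prop36Hypotheses) (hcoh : 𝒢.IsCoherent) : IsTopologicallyFinitelyGenerated (𝒢.temperedPi h36) := by
  haveI : Finite 𝒢.graph.Branch := SemiGraph.finite_branch 𝒢.graph
  obtain ⟨T⟩ := GaloisLevelData.nonempty_pointSeq_family h36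
  obtain ⟨R⟩ := SemiGraph.nonempty_refBranches_of_isConnected 𝒢.graph h36.isConnected (𝒢.baseVertex h36)
  exact GaloisLevelData.isTopologicallyFinitelyGenerated_temperedPi (𝒢.galoisLevelData h36) h36.isCountable T R
    fun w => ⟨hcoh.2.1 w⟩

/-- The characteristic open cores of `π₁^temp(𝒢)` are EXHAUSTIVE (`⋂ = 1`): they are cofinal among the open subgroups of
finite index, and those separate points by the residual finiteness of `π₁^temp(𝒢)` (Prop. 3.6 (iii)).
[cite: MochizukiSemiAnbd2006, Prop 3.6(iii) p.38] -/
theorem charOpenCore_exhaustive_of_chart (h36 : 𝒢.Prop36Hypotheses) (c : TemperedPiChart 𝒢)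
    (hcof : ∀ U : Subgroup c.G, IsOpen (U : Set c.G) → U.FiniteIndex → ∃ i, charOpenCore c.G i ≤ U) (g : c.G)
    (hg : ∀ i, g ∈ charOpenCore c.G i) : g = 1 := by
  by_contra hne
  obtain ⟨N, hNfin, hgN⟩ := TemperedPiResiduallyFinite_holds 𝒢 h36 c g hne
  haveI := hNfin
  haveI : N.toSubgroup.FiniteIndex := Subgroup.finiteIndex_of_finite_quotient
  obtain ⟨i, hi⟩ := hcof N.toSubgroup N.isOpen inferInstance
  exact hgN (hi (hg i))

/-- **[SemiAnbd] Ex. 3.10 — the CANONICAL special-fibre tower over `π₁^temp(𝒢)`**, for every FINITE coherent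
semi-graph of anabelioids `𝒢` with the hypotheses of Thm. 3.7: levels `N_i := charOpenCore (π₁^temp 𝒢) i` (open,
characteristic, normal, finite index, exhaustive, COFINAL), fibres `𝒢_i :=` the covering semi-graphs of anabelioids of
the connected tempered coverings `S_i ↔ π₁^temp(𝒢)/N_i`, charts `π₁^temp(𝒢_i)`, admissible quotients the étale
identifications of Prop. 3.6 (v), admissible kernels `1`, faithful by Prop. 3.6 (iv)
(`SpecialFibreTower.exists_of_coverings_of_finite`).  In particular `SpecialFibreTower (π₁^temp 𝒢)` is inhabited with
GENUINE fibres. [cite: MochizukiSemiAnbd2006, Ex 3.10 p.44] -/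
theorem exists_temperedPi_charOpenCore [Finite 𝒢.graph.Vertex] [Finite 𝒢.graph.Edge] (h37 : 𝒢.Thm37Hypotheses)
    (hcoh : 𝒢.IsCoherent) :
    ∃ T : SpecialFibreTower (𝒢.temperedPi h37.toProp36Hypotheses),
      T.N = charOpenCore (𝒢.temperedPi h37.toProp36Hypotheses) ∧ (∀ i, T.admKer i = ⊥) ∧
      (∀ i, ∃ (S : CovObj 𝒢) (hS : S.IsTempered), T.Gc i = S.coveringGraph ∧ IsConnectedObj (⟨S, hS⟩ : BTempCat 𝒢)) ∧
      ∀ U : Subgroup (𝒢.temperedPi h37.toProp36Hypotheses), IsOpen (U : Set (𝒢.temperedPi h37.toProp36Hypotheses)) →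
        U.FiniteIndex → ∃ i, T.N i ≤ U := by
  have h36 := h37.toProp36Hypotheses
  let c : TemperedPiChart 𝒢 := 𝒢.temperedPiChart h36
  have htfg : IsTopologicallyFinitelyGenerated c.G := isTopologicallyFinitelyGenerated_temperedPi_of_coherent h36 hcoh
  obtain ⟨hanti, hlev, hcof⟩ := charOpenCore_family_of_tfg (Γ := c.G) htfg
  have hchar : ∀ (i) (φ : c.G ≃ₜ* c.G), (charOpenCore c.G i).map φ.toMulEquiv.toMonoidHom = charOpenCore c.G i :=
    fun i φ => (hlev i).2.2.2 φ.toMulEquiv φ.continuous φ.symm.continuous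
  obtain ⟨T, hTN, hadm, hfib⟩ := exists_of_coverings_of_finite h37 hcoh c (charOpenCore c.G) hanti
    (fun i => (hlev i).1) hchar (fun i => (hlev i).2.1) (fun i => (hlev i).2.2.1)
    (charOpenCore_exhaustive_of_chart h36 c hcof)
  refine ⟨T, hTN, hadm, hfib, fun U hU hUf => ?_⟩
  rw [hTN]; exact hcof U hU hUf

/-- **`SpecialFibreTower (π₁^temp 𝒢)` is INHABITED**, with genuine fibres, for every finite coherent Thm-3.7 semi-graph of
anabelioids. [cite: MochizukiSemiAnbd2006, Ex 3.10 p.44] -/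
theorem nonempty_temperedPi [Finite 𝒢.graph.Vertex] [Finite 𝒢.graph.Edge] (h37 : 𝒢.Thm37Hypotheses)
    (hcoh : 𝒢.IsCoherent) : Nonempty (SpecialFibreTower (𝒢.temperedPi h37.toProp36Hypotheses)) := by
  obtain ⟨T, -⟩ := exists_temperedPi_charOpenCore h37 hcoh
  exact ⟨T⟩

end SpecialFibreTower

end Literature.AnabelianGeometry.SemiGraphs

end
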